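import Literature.NumberTheory.Sieve.CoprimeSquarefreeSums

/-!
# SoloInformedCompletelyMultiplicativeFactor — `h₃ = h₁ ⋆ h₂ ⋆ γ` for squarefree-supported multiplicative functions

Solo unit `solo-Parity-informed` (ideation tier, informed mode), session 17; `PLAN.md` §25.3 (α1), CLAIMS C85.

For a real multiplicative arithmetic function `h` supported on squarefree numbers with
`h(p) = -θ(p)`, the completely multiplicative function `β` with `β(p) = θ(p)` is its Dirichlet
inverse (`mul_eq_one_of_prime_pow`; existence of `β`: `exists_isMultiplicative_prime_pow_eq`).
Consequently, for three such functions `hᵢ` with `hᵢ(p) = -rᵢ(p)/p`, `0 ≤ r₁, r₂ ≤ r₃`, the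
function `γ = h₃ ⋆ β₁ ⋆ β₂` satisfies `h₁ ⋆ h₂ ⋆ γ = h₃`, `γ(p) = (r₁(p) + r₂(p) - r₃(p))/p` and
`|γ(p^k)| ≤ (2k+1) (r₃(p)/p)^k` (`exists_conv_factor`).  Applied to `hᵢ = μρᵢ/n` for the root
counts of coprime integer polynomials `G, g, Gg` (where `ρ_{Gg}(p) = ρ_G(p) + ρ_g(p)` for all
large `p`), this and `SoloInformedEulerProductSummability` give the convolution structure
`μρ_{Gg}/n = μρ_G/n ⋆ μρ_g/n ⋆ γ` with `∑ |γ(n)| n^δ < ∞`.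
-/

namespace Summit.Parity.BatemanHorn.Theorems

open Finset ArithmeticFunction
open Literature.NumberTheory.Sieve.SquarefreeSums (mul_apply_prime_pow)

/-- A completely multiplicative real arithmetic function with prescribed values at the primes. -/
theorem exists_isMultiplicative_prime_pow_eq (θ : ℕ → ℝ) :
    ∃ β : ArithmeticFunction ℝ, β.IsMultiplicative ∧ ∀ p k : ℕ, p.Prime → β (p ^ k) = θ p ^ k := by
  refine ⟨⟨fun n => if n = 0 then 0 else n.factorization.prod fun p k => θ p ^ k, if_pos rfl⟩,
    ⟨?_, ?_⟩, ?_⟩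
  · simp only [coe_mk, one_ne_zero, if_false, Nat.factorization_one, Finsupp.prod_zero_index]
  · intro m n _
    simp only [coe_mk]
    rcases eq_or_ne m 0 with rfl | hm
    · simp
    rcases eq_or_ne n 0 with rfl | hn
    · simp
    rw [if_neg hm, if_neg hn, if_neg (mul_ne_zero hm hn), Nat.factorization_mul hm hn,
      Finsupp.prod_add_index' (fun _ => pow_zero _) (fun _ _ _ => pow_add _ _ _)]
  · intro p k hp
    simp only [coe_mk]
    rw [if_neg (pow_ne_zero k hp.ne_zero), hp.factorization_pow,
      Finsupp.prod_single_index (by simp)]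

/-- Convolution with a multiplicative function vanishing on `p^k`, `k ≥ 2`, at a prime power:
`(h ⋆ B)(p^{m+1}) = B(p^{m+1}) + h(p) B(p^m)`. -/
theorem mul_apply_prime_pow_succ_of_vanishing {h B : ArithmeticFunction ℝ} (hh : h.IsMultiplicative)
    (h2 : ∀ p k : ℕ, p.Prime → 2 ≤ k → h (p ^ k) = 0) {p : ℕ} (hp : p.Prime) (m : ℕ) :
    (h * B) (p ^ (m + 1)) = B (p ^ (m + 1)) + h p * B (p ^ m) := by
  rw [mul_apply_prime_pow h B hp (m + 1), sum_range_succ', sum_range_succ']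
  rw [sum_eq_zero (fun j _ => by rw [h2 p (j + 1 + 1) hp (by omega), zero_mul]), zero_add,
    pow_zero, hh.map_one, one_mul, zero_add, pow_one, Nat.sub_zero, Nat.add_sub_cancel, add_comm]

/-- The completely multiplicative `β` with `β(p) = θ(p)` is the Dirichlet inverse of the
squarefree-supported multiplicative `h` with `h(p) = -θ(p)`. -/
theorem mul_eq_one_of_prime_pow {h β : ArithmeticFunction ℝ} (hh : h.IsMultiplicative)
    (hβ : β.IsMultiplicative) {θ : ℕ → ℝ} (h1 : ∀ p : ℕ, p.Prime → h p = -θ p)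
    (h2 : ∀ p k : ℕ, p.Prime → 2 ≤ k → h (p ^ k) = 0)
    (hβp : ∀ p k : ℕ, p.Prime → β (p ^ k) = θ p ^ k) : h * β = 1 := by
  rw [IsMultiplicative.eq_iff_eq_on_prime_powers _ (hh.mul hβ) _ isMultiplicative_one]
  intro p i hp
  rcases i with _ | m
  · rw [pow_zero, (hh.mul hβ).map_one, isMultiplicative_one.map_one]
  · rw [mul_apply_prime_pow_succ_of_vanishing hh h2 hp m, hβp p (m + 1) hp, hβp p m hp, h1 p hp,
      one_apply, if_neg (Nat.one_lt_pow (by omega) hp.one_lt).ne']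
    ring

/-- `|∑_{j ≤ m} θ₁^j θ₂^{m-j}| ≤ (m+1) t^m` for `0 ≤ θ₁, θ₂ ≤ t`. -/
theorem abs_sum_pow_mul_pow_le {θ₁ θ₂ t : ℝ} (h1 : 0 ≤ θ₁) (h2 : 0 ≤ θ₂) (h1t : θ₁ ≤ t)
    (h2t : θ₂ ≤ t) (m : ℕ) :
    |∑ j ∈ range (m + 1), θ₁ ^ j * θ₂ ^ (m - j)| ≤ (m + 1) * t ^ m := by
  rw [abs_of_nonneg (sum_nonneg fun j _ => mul_nonneg (pow_nonneg h1 _) (pow_nonneg h2 _))]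
  calc ∑ j ∈ range (m + 1), θ₁ ^ j * θ₂ ^ (m - j) ≤ ∑ j ∈ range (m + 1), t ^ m := by
        refine sum_le_sum fun j hj => ?_
        have hjm : j ≤ m := Nat.lt_succ_iff.mp (mem_range.mp hj)
        calc θ₁ ^ j * θ₂ ^ (m - j) ≤ t ^ j * t ^ (m - j) :=
              mul_le_mul (pow_le_pow_left₀ h1 h1t j) (pow_le_pow_left₀ h2 h2t _)
                (pow_nonneg h2 _) (pow_nonneg (h1.trans h1t) _)
          _ = t ^ m := by rw [← pow_add, Nat.add_sub_cancel' hjm]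
    _ = (m + 1) * t ^ m := by rw [sum_const, card_range, nsmul_eq_mul]; push_cast; ring

/-- **Structure of `h₃ = h₁ ⋆ h₂ ⋆ γ`.**  See the module docstring. -/
theorem exists_conv_factor {h₁ h₂ h₃ : ArithmeticFunction ℝ} (hm₁ : h₁.IsMultiplicative)
    (hm₂ : h₂.IsMultiplicative) (hm₃ : h₃.IsMultiplicative) {r₁ r₂ r₃ : ℕ → ℝ}
    (hp₁ : ∀ p : ℕ, p.Prime → h₁ p = -(r₁ p / p)) (hp₂ : ∀ p : ℕ, p.Prime → h₂ p = -(r₂ p / p))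
    (hp₃ : ∀ p : ℕ, p.Prime → h₃ p = -(r₃ p / p))
    (hpp₁ : ∀ p k : ℕ, p.Prime → 2 ≤ k → h₁ (p ^ k) = 0)
    (hpp₂ : ∀ p k : ℕ, p.Prime → 2 ≤ k → h₂ (p ^ k) = 0)
    (hpp₃ : ∀ p k : ℕ, p.Prime → 2 ≤ k → h₃ (p ^ k) = 0)
    (h0 : ∀ p : ℕ, p.Prime → 0 ≤ r₁ p ∧ 0 ≤ r₂ p)
    (hle : ∀ p : ℕ, p.Prime → r₁ p ≤ r₃ p ∧ r₂ p ≤ r₃ p) :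
    ∃ γ : ArithmeticFunction ℝ, γ.IsMultiplicative ∧ h₁ * h₂ * γ = h₃ ∧
      (∀ p : ℕ, p.Prime → γ p = (r₁ p + r₂ p - r₃ p) / p) ∧
      ∀ p k : ℕ, p.Prime → 1 ≤ k → |γ (p ^ k)| ≤ (2 * k + 1) * (r₃ p / p) ^ k := by
  obtain ⟨β₁, hβ₁, hβ₁p⟩ := exists_isMultiplicative_prime_pow_eq fun p => r₁ p / p
  obtain ⟨β₂, hβ₂, hβ₂p⟩ := exists_isMultiplicative_prime_pow_eq fun p => r₂ p / p
  have e₁ : h₁ * β₁ = 1 := mul_eq_one_of_prime_pow hm₁ hβ₁ hp₁ hpp₁ hβ₁p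
  have e₂ : h₂ * β₂ = 1 := mul_eq_one_of_prime_pow hm₂ hβ₂ hp₂ hpp₂ hβ₂p
  set B : ArithmeticFunction ℝ := β₁ * β₂ with hBdef
  have hBm : B.IsMultiplicative := hβ₁.mul hβ₂
  -- `B` at prime powers
  have hB : ∀ p m : ℕ, p.Prime →
      B (p ^ m) = ∑ j ∈ range (m + 1), (r₁ p / p) ^ j * (r₂ p / p) ^ (m - j) := by
    intro p m hp
    rw [hBdef, mul_apply_prime_pow β₁ β₂ hp m]
    exact sum_congr rfl fun j _ => by rw [hβ₁p p j hp, hβ₂p p (m - j) hp]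
  have hBabs : ∀ p m : ℕ, p.Prime → |B (p ^ m)| ≤ (m + 1) * (r₃ p / p) ^ m := by
    intro p m hp
    have hp0 : (0 : ℝ) < p := by exact_mod_cast hp.pos
    rw [hB p m hp]
    exact abs_sum_pow_mul_pow_le (div_nonneg (h0 p hp).1 hp0.le) (div_nonneg (h0 p hp).2 hp0.le)
      (div_le_div_of_nonneg_right (hle p hp).1 hp0.le)
      (div_le_div_of_nonneg_right (hle p hp).2 hp0.le) m
  refine ⟨h₃ * B, hm₃.mul hBm, ?_, ?_, ?_⟩
  · -- the convolution identity
    calc h₁ * h₂ * (h₃ * B) = h₃ * ((h₁ * β₁) * (h₂ * β₂)) := by rw [hBdef]; ring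
      _ = h₃ := by rw [e₁, e₂, mul_one, mul_one]
  · -- the value at a prime
    intro p hp
    have := mul_apply_prime_pow_succ_of_vanishing (B := B) hm₃ hpp₃ hp 0
    rw [zero_add, pow_one, pow_zero, hBm.map_one, mul_one, hp₃ p hp] at this
    rw [this]
    have hB1 := hB p 1 hp
    rw [pow_one] at hB1
    rw [hB1, sum_range_succ, sum_range_one]
    simp only [pow_zero, Nat.sub_zero, pow_one, one_mul, Nat.sub_self, mul_one]
    ring
  · -- prime powers
    intro p k hp hk
    obtain ⟨m, rfl⟩ : ∃ m, k = m + 1 := ⟨k - 1, by omega⟩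
    have ht0 : 0 ≤ r₃ p / p :=
      div_nonneg ((h0 p hp).1.trans (hle p hp).1) (Nat.cast_nonneg p)
    rw [mul_apply_prime_pow_succ_of_vanishing (B := B) hm₃ hpp₃ hp m, hp₃ p hp]
    calc |B (p ^ (m + 1)) + -(r₃ p / p) * B (p ^ m)|
        ≤ |B (p ^ (m + 1))| + |-(r₃ p / p) * B (p ^ m)| := abs_add_le _ _
      _ = |B (p ^ (m + 1))| + r₃ p / p * |B (p ^ m)| := by
          rw [abs_mul, abs_neg, abs_of_nonneg ht0]
      _ ≤ (↑(m + 1) + 1) * (r₃ p / p) ^ (m + 1) + r₃ p / p * ((m + 1) * (r₃ p / p) ^ m) := by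
          have h1 := hBabs p (m + 1) hp
          have h2 := hBabs p m hp
          push_cast at h1 ⊢
          exact add_le_add h1 (mul_le_mul_of_nonneg_left h2 ht0)
      _ = (2 * ↑(m + 1) + 1) * (r₃ p / p) ^ (m + 1) := by push_cast; ring

end Summit.Parity.BatemanHorn.Theorems
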